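import Summits.CriticalPhenomena.PercolationContinuityZ3.Theorems.SahiMasterFamilySparseEndAll

/-!
# The sparse end of Sahi's hierarchy, III: the signed partition sum of a UNION-CLOSED family is nonnegative

Support file of the master-family programme (crux `NoHeavyLowerTail`, stmt-CriticalPhenomena-4575; cell `prim-masterthm`, seat P4,
unit `prim-masterthm-p4-g4`).  Seat document PROOF-SPARSE-END.md, Theorem 3 (B).  With `SahiMasterFamilySparseEndPartitions`
(`parts`, `Z`, `N`) and `SahiMasterFamilySparseEndAll` (`Zall_nonpos`):

* `Z_eq_zero_of_not_mem` — if `Q` is closed under unions and `Y ∉ Q` (`Y ≠ ∅`) there is no `Q`-partition of `Y`;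
* `Z_insert` — adjoining a non-member `A`: `Z_{Q∪{A}}(X) = Z_Q(X) − (b_A−1)!·Z_Q(X∖A)`;
* **`Z_nonpos` / `N_nonneg`**: for `X ≠ ∅`, `Q ⊆ 2^X` closed under pairwise unions with `X ∈ Q`, and `b ≥ 1`:
  `N_Q(b; X) = Σ_{τ partition of X, blocks in Q} (−1)^{|τ|+1} ∏_T (b_T − 1)! ≥ 0` (induction on `|X|` and on the number of
  non-members, adjoining a maximal non-member each time); `Nall_nonneg`.
MEANING (seat document §1–2): `N_Q(b)` is the coefficient structure of the leading term `p^m` of Sahi's `E_k` for increasing events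
under a sparse product measure; so the first sparse obstruction to `(M-k)` never occurs, for any `k`.  The Lean link from `E_k` to
`N_Q` (cores, principal blocks) is future work; here only the combinatorial inequality is proved.
HONEST FRAMING: elementary; [this work].  `C_n` for product measures [Sahi2008, Conj. 5; Kahn2022, Conj. 5] remains open.
-/

namespace Summit.CriticalPhenomena.PercolationContinuityZ3.Theorems

namespace SahiSparseEnd

open Finset

variable {α : Type*} [DecidableEq α]

/-! ### General union-closed families: adjoining maximal non-members -/

/-- Blocks of a `Q`-partition of a nonempty `Y` have union `Y`; if `Q` is closed under unions then `Y ∈ Q`.  Hence if `Y ∉ Q`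
there is no `Q`-partition of `Y` and `Z_Q(Y) = 0`. [this work] -/
theorem Z_eq_zero_of_not_mem {Q : Finset (Finset α)} (hQ : ∀ A ∈ Q, ∀ B ∈ Q, A ∪ B ∈ Q) (b : α → ℕ) {Y : Finset α}
    (hY : Y.Nonempty) (hYQ : Y ∉ Q) : Z Q b Y = 0 := by
  refine sum_eq_zero fun P hP => ?_
  exfalso
  rw [mem_filter] at hP
  obtain ⟨hP, hPQ⟩ := hP
  have hparts := mem_parts.1 hP
  -- the union of a nonempty subfamily of `Q` lies in `Q`
  have hunion : ∀ R : Finset (Finset α), R ⊆ P → R.Nonempty → R.biUnion id ∈ Q := by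
    intro R
    induction R using Finset.induction_on with
    | empty => intro _ h; exact absurd h (by simp)
    | insert A R hA ihR =>
      intro hR _
      rcases R.eq_empty_or_nonempty with hRe | hRne
      · rw [hRe, insert_empty, singleton_biUnion, id]
        exact hPQ (hR (mem_insert_self _ _))
      · rw [biUnion_insert, id]
        exact hQ _ (hPQ (hR (mem_insert_self _ _))) _ (ihR ((subset_insert _ _).trans hR) hRne)
  obtain ⟨y, hy⟩ := hY
  obtain ⟨T, hT, -⟩ := hparts.2.2 y hy
  have hPne : P.Nonempty := ⟨T, hT⟩
  have hU : P.biUnion id = Y := by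
    ext x
    rw [mem_biUnion]
    constructor
    · rintro ⟨T, hT, hx⟩; exact (hparts.1 T hT).2 hx
    · intro hx
      obtain ⟨T, hT, hxT⟩ := hparts.2.2 x hx
      exact ⟨T, hT, hxT⟩
  exact hYQ (hU ▸ hunion P subset_rfl hPne)

/-- `Z_Q(Y)` only sees the members of `Q` inside `Y`. [this work] -/
theorem Z_restrict (Q : Finset (Finset α)) (b : α → ℕ) (Y : Finset α) :
    Z Q b Y = Z (Q.filter fun A => A ⊆ Y) b Y := by
  refine sum_congr ?_ fun _ _ => rfl
  ext P
  simp only [mem_filter]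
  constructor
  · rintro ⟨hP, hPQ⟩
    exact ⟨hP, fun T hT => mem_filter.2 ⟨hPQ hT, ((mem_parts.1 hP).1 T hT).2⟩⟩
  · rintro ⟨hP, hPQ⟩
    exact ⟨hP, fun T hT => (mem_filter.1 (hPQ hT)).1⟩

/-- **Adjoining a maximal non-member**: if `A ∉ Q`, `∅ ≠ A ⊆ X`, then
`Z_{Q ∪ {A}}(X) = Z_Q(X) − (b_A − 1)!·Z_Q(X \ A)`. [this work] -/
theorem Z_insert {Q : Finset (Finset α)} {b : α → ℕ} {X A : Finset α} (hAX : A ⊆ X) (hA : A.Nonempty) (hAQ : A ∉ Q) :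
    Z (insert A Q) b X = Z Q b X + (-bw b A) * Z Q b (X \ A) := by
  rw [Z, ← sum_filter_add_sum_filter_not ((parts X).filter fun P => P ⊆ insert A Q) (fun P => A ∈ P)]
  rw [add_comm]
  congr 1
  · refine sum_congr ?_ fun _ _ => rfl
    ext P
    simp only [mem_filter]
    constructor
    · rintro ⟨⟨hP, hsub⟩, hAP⟩
      exact ⟨hP, fun T hT => (mem_insert.1 (hsub hT)).resolve_left fun e => hAP (e ▸ hT)⟩
    · rintro ⟨hP, hsub⟩
      exact ⟨⟨hP, hsub.trans (subset_insert _ _)⟩, fun h => hAQ (hsub h)⟩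
  · rw [filter_filter, Z, mul_sum]
    have : (parts X).filter (fun P => P ⊆ insert A Q ∧ A ∈ P) = ((parts X).filter fun P => A ∈ P).filter
        (fun P => P ⊆ insert A Q) := by
      rw [filter_filter]; exact filter_congr fun P _ => and_comm
    rw [this, sum_filter, sum_parts_with_block hAX hA, ← sum_filter]
    refine sum_congr ?_ fun P hP => ?_
    · ext P
      simp only [mem_filter]
      constructor
      · rintro ⟨hP, hsub⟩
        refine ⟨hP, fun T hT => (mem_insert.1 (hsub (mem_insert_of_mem hT))).resolve_left fun e => ?_⟩
        exact not_mem_of_mem_parts_sdiff hP hA (e ▸ hT)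
      · rintro ⟨hP, hsub⟩
        exact ⟨hP, insert_subset_insert A hsub⟩
    · rw [mem_filter] at hP
      rw [prod_insert (not_mem_of_mem_parts_sdiff hP.1 hA)]

/-- **THEOREM (the signed partition sum of a union-closed family is nonpositive / `N_Q ≥ 0`).**  For every finite `X ≠ ∅`, every
family `Q` of subsets of `X` closed under pairwise unions with `X ∈ Q`, and weights `b ≥ 1`: `Z_Q(b; X) ≤ 0`. [this work] -/
theorem Z_nonpos (b : α → ℕ) (hb : ∀ x, 1 ≤ b x) : ∀ (n : ℕ) (X : Finset α), X.card = n → X.Nonempty →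
    ∀ Q : Finset (Finset α), Q ⊆ X.powerset → (∀ A ∈ Q, ∀ B ∈ Q, A ∪ B ∈ Q) → X ∈ Q → Z Q b X ≤ 0 := by
  intro n
  induction n using Nat.strong_induction_on with
  | _ n ihX =>
    intro X hXn hX
    -- inner induction on the number of nonempty non-members
    suffices h : ∀ (m : ℕ) (Q : Finset (Finset α)), (X.powerset.filter fun A => A.Nonempty ∧ A ∉ Q).card = m →
        Q ⊆ X.powerset → (∀ A ∈ Q, ∀ B ∈ Q, A ∪ B ∈ Q) → X ∈ Q → Z Q b X ≤ 0 from
      fun Q => h _ Q rfl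
    intro m
    induction m using Nat.strong_induction_on with
    | _ m ihQ =>
      intro Q hm hQX hQ hXQ
      rcases Nat.eq_zero_or_pos m with hm0 | hmpos
      · -- every nonempty subset of X is in Q
        have hall : ∀ A, A ⊆ X → A.Nonempty → A ∈ Q := by
          intro A hAX hA
          by_contra hAQ
          have : A ∈ X.powerset.filter (fun A => A.Nonempty ∧ A ∉ Q) :=
            mem_filter.2 ⟨mem_powerset.2 hAX, hA, hAQ⟩
          rw [hm0] at hm
          exact absurd (card_pos.2 ⟨A, this⟩) (by omega)
        rw [Z_eq_Zall hall]
        exact Zall_nonpos _ X b hb rfl hX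
      · -- pick a non-member of maximal cardinality
        obtain ⟨A, hAmem, hAmax⟩ := exists_max_image (X.powerset.filter fun A => A.Nonempty ∧ A ∉ Q) Finset.card
          (card_pos.1 (by omega))
        rw [mem_filter, mem_powerset] at hAmem
        obtain ⟨hAX, hAne, hAQ⟩ := hAmem
        have hAneX : A ≠ X := fun e => hAQ (e ▸ hXQ)
        -- Q' = insert A Q is union-closed
        have hQ'X : insert A Q ⊆ X.powerset := insert_subset (mem_powerset.2 hAX) hQX
        have hQ' : ∀ B ∈ insert A Q, ∀ C ∈ insert A Q, B ∪ C ∈ insert A Q := by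
          have key : ∀ C ∈ Q, A ∪ C ∈ insert A Q := by
            intro C hC
            by_cases h : A ∪ C = A
            · rw [h]; exact mem_insert_self _ _
            · refine mem_insert_of_mem ?_
              by_contra hAC
              have hACX : A ∪ C ⊆ X := union_subset hAX (mem_powerset.1 (hQX hC))
              have hlt : A.card < (A ∪ C).card :=
                card_lt_card (ssubset_of_ne_of_subset (Ne.symm h) subset_union_left)
              have := hAmax (A ∪ C) (mem_filter.2 ⟨mem_powerset.2 hACX, ⟨_, (mem_union_left C hAne.choose_spec)⟩, hAC⟩)
              omega
          intro B hB C hC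
          rcases mem_insert.1 hB with rfl | hB <;> rcases mem_insert.1 hC with hCA | hC
          · rw [hCA, union_self]; exact mem_insert_self _ _
          · exact key C hC
          · rw [hCA, union_comm]; exact key B hB
          · exact mem_insert_of_mem (hQ B hB C hC)
        have hm' : (X.powerset.filter fun A' => A'.Nonempty ∧ A' ∉ insert A Q).card < m := by
          rw [← hm]
          refine card_lt_card (Finset.ssubset_iff_subset_ne.2 ⟨fun B hB => ?_, fun e => ?_⟩)
          · rw [mem_filter] at hB ⊢
            exact ⟨hB.1, hB.2.1, fun h => hB.2.2 (mem_insert_of_mem h)⟩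
          · have : A ∈ X.powerset.filter (fun A' => A'.Nonempty ∧ A' ∉ insert A Q) := by
              rw [e]; exact mem_filter.2 ⟨mem_powerset.2 hAX, hAne, hAQ⟩
            exact (mem_filter.1 this).2.2 (mem_insert_self _ _)
        have h1 : Z (insert A Q) b X ≤ 0 := ihQ _ hm' (insert A Q) rfl hQ'X hQ' (mem_insert_of_mem hXQ)
        -- the correction term
        have hXA : (X \ A).Nonempty := by
          rw [sdiff_nonempty]
          exact fun h => hAneX (subset_antisymm hAX h)
        have h2 : Z Q b (X \ A) ≤ 0 := by
          by_cases hXAQ : X \ A ∈ Q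
          · rw [Z_restrict]
            refine ihX (X \ A).card (by rw [← hXn]; exact card_lt_card (sdiff_ssubset hAX hAne)) (X \ A) rfl hXA
              (Q.filter fun B => B ⊆ X \ A) (fun B hB => mem_powerset.2 (mem_filter.1 hB).2) ?_
              (mem_filter.2 ⟨hXAQ, subset_rfl⟩)
            intro B hB C hC
            rw [mem_filter] at hB hC ⊢
            exact ⟨hQ B hB.1 C hC.1, union_subset hB.2 hC.2⟩
          · rw [Z_eq_zero_of_not_mem hQ b hXA hXAQ]
        rw [Z_insert hAX hAne hAQ] at h1
        have hbw : (0 : ℤ) ≤ bw b A := by unfold bw; positivity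
        nlinarith

/-- **`N_Q(b) ≥ 0`** — headline form.  For a nonempty finite `X`, a family `Q` of subsets of `X` closed under pairwise unions and
containing `X`, and weights `b ≥ 1`:  `Σ_{τ partition of X, blocks in Q} (−1)^{|τ|+1} ∏_{T∈τ} (b_T − 1)! ≥ 0`. [this work] -/
theorem N_nonneg {X : Finset α} (hX : X.Nonempty) {Q : Finset (Finset α)} (hQX : Q ⊆ X.powerset)
    (hQ : ∀ A ∈ Q, ∀ B ∈ Q, A ∪ B ∈ Q) (hXQ : X ∈ Q) {b : α → ℕ} (hb : ∀ x, 1 ≤ b x) : 0 ≤ N Q b X := by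
  rw [N_eq_neg_Z]
  have := Z_nonpos b hb X.card X rfl hX Q hQX hQ hXQ
  linarith

/-- The all-subsets case: `Σ_{τ partition of X} (−1)^{|τ|+1} ∏_T (b_T − 1)! ≥ 0`. [this work] -/
theorem Nall_nonneg {X : Finset α} (hX : X.Nonempty) {b : α → ℕ} (hb : ∀ x, 1 ≤ b x) : 0 ≤ N X.powerset b X :=
  N_nonneg hX subset_rfl (fun _ hA _ hB => mem_powerset.2 (union_subset (mem_powerset.1 hA) (mem_powerset.1 hB)))
    (mem_powerset.2 subset_rfl) hb

end SahiSparseEnd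

end Summit.CriticalPhenomena.PercolationContinuityZ3.Theorems
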